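import Summits.AnomalousDissipation.AnomalousDissipation.Theorems.WindLineWindyGalerkinSteadyZerothLawCategoryBirth

/-!
# `WindLine.WindyGalerkinSteadyZerothLaw` (stmt-AnomalousDissipation-11414): birth of the heart from a MENU-form category stub (line `registered`, rev 8)

Support file for the crux (lands `--supports stmt-AnomalousDissipation-11414`; pure proof file).  Rev 7 (`…CategoryBirth.lean`, p160369;
`…RobustBirth.lean`, p160686) showed that the category stub P — a non-meagre set of entire forces obeying the steady zeroth law along ONE
viscosity sequence `ν_j` with ONE momentum sequence `m_j` — is EQUIVALENT (up to slack) to ν-uniform force-robustness R₀, because the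
every-level loud sets are closed.  Rev 8 removes the pins: the physics stub becomes

* (P′) MENU FORM: for some COUNTABLE MENUS of viscosities `ν : ℕ → (0,∞)` and momenta `m : ℕ → ℝ³` and budgets `E, ε > 0`, the set of
  parameters `c ∈ 𝒜` such that FOR EVERY `n` the force `F⟦c⟧` carries, at SOME menu viscosity `ν i < 1/(n+1)` and SOME menu momentum `m i'`,
  a classical steady state with `∫u = m i'`, `∫|u|² < E`, `ε < ν i‖∇u‖²`, is NOT MEAGRE in `𝒜`

— each force may use its own viscosities and momenta from the menus.  The composition survives verbatim because generic leaf-nondegeneracy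
(stub B, landed) is available at EVERY `(ν, m)`, hence simultaneously at the countably many menu pairs:

* `loudNondegenerateSteadyStates_of_nonMeagreMenu` : P′ → B → D → HEART (residual set `⋂_{i,i'} interior G(ν i, m i')`, a non-meagre set
  meets it; along `n` the chosen menu viscosities tend to `0`);
* `windyGalerkinSteadyZerothLaw_of_menuBirth` : P′ → B → D → X BY NAME; `steadyZerothLaw_of_menuBirth`, `anomalousDissipation_of_menuBirth`;
* `nonMeagreMenu_of_nonMeagreLoud` : P → P′ (rev 8 asks no more than rev 7; with `nonMeagreLoud_of_denseLoud` also A → P′).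

Why P′ is the better stub: the set in P′ is an `F_{σδ}` (countable unions enter through the menus), so the closedness argument of
`robustLoud_of_nonMeagreLoud` no longer forces a common open set of forces — P′ is a category statement that is NOT provably ν-uniform
robustness, while P ⟺ R₀ was.  P′ is still summit-strength (`steadyZerothLaw_of_menuBirth` needs only P′: a non-meagre set is non-empty).

References: Foias–Temam 1976/77/78 (generic regularity at fixed `(ν, m)`); Oxtoby, *Measure and Category* Ch. 9; route file `Theses/WindLine.lean`;
skeleton `Cruxes/WindyGalerkinSteadyZerothLaw/Lines/birth.lean` rev 8.
-/

noncomputable section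

-- D-0017: single-problem summit ⇒ the duplicated namespace segment is by design.
set_option linter.dupNamespace false

open scoped InnerProductSpace Topology ComplexConjugate
open MeasureTheory Filter UnitAddTorus Set
open Literature.Analysis.FunctionSpaces Literature.Analysis.FunctionSpaces.Torus
open Literature.Analysis.FunctionSpaces.EuclideanSpace
open Literature.Analysis.FluidPDE Literature.Analysis.FluidPDE.Torus

namespace Summit.AnomalousDissipation.AnomalousDissipation.Theorems.WindLineWindyGalerkinSteadyZerothLaw

/-- The flat three-torus (local notation). -/
local notation "𝕋³" => UnitAddTorus (Fin 3)
/-- Velocity values (local notation). -/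
local notation "E³" => EuclideanSpace ℝ (Fin 3)
set_option quotPrecheck false in
/-- **The admissible parameter set** `𝒜 ⊆ SymL2 (Fin 3)` (local notation, as in the sibling files). -/
local notation "𝒜" => ({c : SymL2 (Fin 3) | c 0 = 0 ∧
  ∀ k : Fin 3 → ℤ, ∑ j : Fin 3, ((k j : ℤ) : ℂ) * c k j = 0} : Set (SymL2 (Fin 3)))
/-- **The force of a parameter** (local notation, as in the sibling files). -/
local notation "F⟦" c "⟧" => SymL2.field (fun k : Fin 3 → ℤ => Real.exp (freqNormSq k)) (c : SymL2 (Fin 3))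

/-- **P′ ∧ B ∧ D ⇒ HEART (birth from the menu form).**  B at every menu pair `(ν i, m i')` gives countably many open dense sets whose
intersection `G` is residual; the non-meagre set of P′ meets `G` at some `c⋆`; for every `n` choose (choice) a menu viscosity
`ν (i n) < 1/(n+1)`, a menu momentum and a loud bounded steady state of `F⟦c⋆⟧` — nondegenerate since `c⋆ ∈ G(ν (i n), m (i' n))`; the
viscosities `ν (i n)` are positive and tend to `0` (squeezed by `1/(n+1)`), and D makes `F⟦c⋆⟧` smooth, divergence free and mean zero. -/
theorem loudNondegenerateSteadyStates_of_nonMeagreMenu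
    (hP : ∃ (ν : ℕ → ℝ) (m : ℕ → E³) (E ε : ℝ), (∀ i, 0 < ν i) ∧ 0 < ε ∧
      ¬ IsMeagre {c : 𝒜 | ∀ n : ℕ, ∃ i : ℕ, ν i < 1 / ((n : ℝ) + 1) ∧ ∃ (i' : ℕ) (u : 𝕋³ → E³) (p : 𝕋³ → ℝ),
          IsSteadyNSState (ν i) F⟦c⟧ u p ∧ ∫ x, u x = m i' ∧
            ∫ x, ‖u x‖ ^ 2 < E ∧ ε < ν i * gradNormSq u})
    (hB : ∀ (ν : ℝ) (m : E³), 0 < ν →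
      Dense (interior {c : 𝒜 | ∀ (u : 𝕋³ → E³) (p : 𝕋³ → ℝ),
        IsSteadyNSState ν F⟦c⟧ u p → ∫ x, u x = m → ¬ IsLinNSEigenvalue ν u 0}))
    (hD : ∀ c : 𝒜, IsSmooth F⟦c⟧ ∧ IsDivFree F⟦c⟧ ∧ HasZeroMean F⟦c⟧) :
    ∃ f : 𝕋³ → E³, IsSmooth f ∧ IsDivFree f ∧ HasZeroMean f ∧
      ∃ (ν : ℕ → ℝ) (E ε : ℝ), (∀ j, 0 < ν j) ∧ Tendsto ν atTop (𝓝 0) ∧ 0 < ε ∧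
        ∀ j, ∃ (u : 𝕋³ → E³) (p : 𝕋³ → ℝ),
          IsSteadyNSState (ν j) f u p ∧ ¬ IsLinNSEigenvalue (ν j) u 0 ∧
            ∫ x, ‖u x‖ ^ 2 < E ∧ ε < ν j * gradNormSq u := by
  obtain ⟨ν, m, E, ε, hν, hε, hL⟩ := hP
  -- the residual set of parameters that are fully leaf-nondegenerate at every menu pair
  set O : ℕ × ℕ → Set 𝒜 := fun q => interior {c : 𝒜 | ∀ (u : 𝕋³ → E³) (p : 𝕋³ → ℝ),
    IsSteadyNSState (ν q.1) F⟦c⟧ u p → ∫ x, u x = m q.2 → ¬ IsLinNSEigenvalue (ν q.1) u 0} with hO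
  have hres : (⋂ q, O q) ∈ residual 𝒜 :=
    countable_iInter_mem.2 fun q => residual_of_dense_open isOpen_interior (hB (ν q.1) (m q.2) (hν q.1))
  -- a non-meagre set meets every residual set
  have hmeet : ({c : 𝒜 | ∀ n : ℕ, ∃ i : ℕ, ν i < 1 / ((n : ℝ) + 1) ∧ ∃ (i' : ℕ) (u : 𝕋³ → E³) (p : 𝕋³ → ℝ),
      IsSteadyNSState (ν i) F⟦c⟧ u p ∧ ∫ x, u x = m i' ∧
        ∫ x, ‖u x‖ ^ 2 < E ∧ ε < ν i * gradNormSq u} ∩ ⋂ q, O q).Nonempty := by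
    by_contra h
    rw [not_nonempty_iff_eq_empty] at h
    apply hL
    rw [IsMeagre]
    refine Filter.mem_of_superset hres fun c hc hcL => ?_
    have : c ∈ (∅ : Set 𝒜) := h ▸ ⟨hcL, hc⟩
    exact this
  obtain ⟨c, hcL, hcO⟩ := hmeet
  obtain ⟨hs, hdf, hmz⟩ := hD c
  choose i hi i' u p hst hm hE hεu using hcL
  refine ⟨F⟦c⟧, hs, hdf, hmz, fun n => ν (i n), E, ε, fun n => hν (i n), ?_, hε, fun n => ?_⟩
  · -- `0 < ν (i n) < 1/(n+1)`, so the chosen viscosities tend to `0`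
    have h1 : Tendsto (fun n : ℕ => 1 / ((n : ℝ) + 1)) atTop (𝓝 0) := tendsto_one_div_add_atTop_nhds_zero_nat
    exact squeeze_zero (fun n => (hν (i n)).le) (fun n => (hi n).le) h1
  · have hcG := interior_subset (mem_iInter.1 hcO (i n, i' n))
    simp only [mem_setOf_eq] at hcG
    exact ⟨u n, p n, hst n, hcG (u n) (p n) (hst n) (hm n), hE n, hεu n⟩

/-- **THE MENU BIRTH CLOSES THE CRUX BY NAME: P′ → B → D → X**, through `loudNondegenerateSteadyStates_of_nonMeagreMenu` and the landed
transfer `windyGalerkinSteadyZerothLaw_of_loudNondegenerateSteadyStates`. -/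
theorem windyGalerkinSteadyZerothLaw_of_menuBirth :
    (∃ (ν : ℕ → ℝ) (m : ℕ → E³) (E ε : ℝ), (∀ i, 0 < ν i) ∧ 0 < ε ∧
      ¬ IsMeagre {c : 𝒜 | ∀ n : ℕ, ∃ i : ℕ, ν i < 1 / ((n : ℝ) + 1) ∧ ∃ (i' : ℕ) (u : 𝕋³ → E³) (p : 𝕋³ → ℝ),
          IsSteadyNSState (ν i) F⟦c⟧ u p ∧ ∫ x, u x = m i' ∧
            ∫ x, ‖u x‖ ^ 2 < E ∧ ε < ν i * gradNormSq u}) →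
    (∀ (ν : ℝ) (m : E³), 0 < ν →
      Dense (interior {c : 𝒜 | ∀ (u : 𝕋³ → E³) (p : 𝕋³ → ℝ),
        IsSteadyNSState ν F⟦c⟧ u p → ∫ x, u x = m → ¬ IsLinNSEigenvalue ν u 0})) →
    (∀ c : 𝒜, IsSmooth F⟦c⟧ ∧ IsDivFree F⟦c⟧ ∧ HasZeroMean F⟦c⟧) →
    Summit.AnomalousDissipation.AnomalousDissipation.Theses.WindLine.WindyGalerkinSteadyZerothLaw :=
  fun hP hB hD =>
    windyGalerkinSteadyZerothLaw_of_loudNondegenerateSteadyStates (loudNondegenerateSteadyStates_of_nonMeagreMenu hP hB hD)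

/-- **P′ → `CoherentStates.SteadyZerothLaw` (stmt-0219) BY NAME** (P′ ALONE: a non-meagre set is non-empty, and any of its forces obeys the
steady zeroth law along the chosen menu viscosities; strict budgets give the non-strict ones; D is the landed force dictionary). -/
theorem steadyZerothLaw_of_menuStub :
    (∃ (ν : ℕ → ℝ) (m : ℕ → E³) (E ε : ℝ), (∀ i, 0 < ν i) ∧ 0 < ε ∧
      ¬ IsMeagre {c : 𝒜 | ∀ n : ℕ, ∃ i : ℕ, ν i < 1 / ((n : ℝ) + 1) ∧ ∃ (i' : ℕ) (u : 𝕋³ → E³) (p : 𝕋³ → ℝ),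
          IsSteadyNSState (ν i) F⟦c⟧ u p ∧ ∫ x, u x = m i' ∧
            ∫ x, ‖u x‖ ^ 2 < E ∧ ε < ν i * gradNormSq u}) →
    Summit.AnomalousDissipation.AnomalousDissipation.Theses.CoherentStates.SteadyZerothLaw := by
  rintro ⟨ν, m, E, ε, hν, hε, hL⟩
  obtain ⟨c, hc⟩ := nonempty_of_not_isMeagre hL
  choose i hi i' u p hst hm hE hεu using hc
  obtain ⟨hs, hdf, hmz⟩ := stub_forceDictionary c
  have h0 : Tendsto (fun n => ν (i n)) atTop (𝓝 0) :=
    squeeze_zero (fun n => (hν (i n)).le) (fun n => (hi n).le) tendsto_one_div_add_atTop_nhds_zero_nat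
  exact ⟨F⟦c⟧, hs, hdf, hmz, fun n => ν (i n), u, p, fun n => hν (i n), h0, fun n => hst n, ⟨E, fun n => (hE n).le⟩, ε, hε,
    fun n => (hεu n).le⟩

/-- **P′ → `AnomalousDissipation`** (the summit statement, by name, CONDITIONALLY on the open stub P′), through `steadyZerothLaw_of_menuStub`,
the landed `steadyImpliesCoherent_proof` and `CoherentStates.closes`: the reshaped stub is still summit-strength, kernel-checked. -/
theorem anomalousDissipation_of_menuStub :
    (∃ (ν : ℕ → ℝ) (m : ℕ → E³) (E ε : ℝ), (∀ i, 0 < ν i) ∧ 0 < ε ∧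
      ¬ IsMeagre {c : 𝒜 | ∀ n : ℕ, ∃ i : ℕ, ν i < 1 / ((n : ℝ) + 1) ∧ ∃ (i' : ℕ) (u : 𝕋³ → E³) (p : 𝕋³ → ℝ),
          IsSteadyNSState (ν i) F⟦c⟧ u p ∧ ∫ x, u x = m i' ∧
            ∫ x, ‖u x‖ ^ 2 < E ∧ ε < ν i * gradNormSq u}) →
    _root_.AnomalousDissipation :=
  fun hP => Summit.AnomalousDissipation.AnomalousDissipation.Theses.CoherentStates.closes
    (Theorems.steadyImpliesCoherent_proof (steadyZerothLaw_of_menuStub hP))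

/-- **MONOTONICITY CERTIFICATE: P → P′** (rev 8 asks no more than rev 7).  With P's data take the same sequences as menus; a parameter good
for P is good for P′: at stage `n` pick a level `j` with `ν j < 1/(n+1)` (`ν_j → 0`) and the loud state of momentum `m j` there. -/
theorem nonMeagreMenu_of_nonMeagreLoud
    (hP : ∃ (ν : ℕ → ℝ) (m : ℕ → E³) (E ε : ℝ), (∀ j, 0 < ν j) ∧ Tendsto ν atTop (𝓝 0) ∧ 0 < ε ∧
      ¬ IsMeagre {c : 𝒜 | ∀ j, ∃ (u : 𝕋³ → E³) (p : 𝕋³ → ℝ),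
          IsSteadyNSState (ν j) F⟦c⟧ u p ∧ ∫ x, u x = m j ∧
            ∫ x, ‖u x‖ ^ 2 < E ∧ ε < ν j * gradNormSq u}) :
    ∃ (ν : ℕ → ℝ) (m : ℕ → E³) (E ε : ℝ), (∀ i, 0 < ν i) ∧ 0 < ε ∧
      ¬ IsMeagre {c : 𝒜 | ∀ n : ℕ, ∃ i : ℕ, ν i < 1 / ((n : ℝ) + 1) ∧ ∃ (i' : ℕ) (u : 𝕋³ → E³) (p : 𝕋³ → ℝ),
          IsSteadyNSState (ν i) F⟦c⟧ u p ∧ ∫ x, u x = m i' ∧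
            ∫ x, ‖u x‖ ^ 2 < E ∧ ε < ν i * gradNormSq u} := by
  obtain ⟨ν, m, E, ε, hν, hν0, hε, hL⟩ := hP
  refine ⟨ν, m, E, ε, hν, hε, fun hM => hL (hM.mono ?_)⟩
  intro c hc n
  obtain ⟨j, hj⟩ := (hν0.eventually (gt_mem_nhds (by positivity : (0 : ℝ) < 1 / ((n : ℝ) + 1)))).exists
  obtain ⟨u, p, hst, hm, hE, hεu⟩ := hc j
  exact ⟨j, hj, j, u, p, hst, hm, hE, hεu⟩

end Summit.AnomalousDissipation.AnomalousDissipation.Theorems.WindLineWindyGalerkinSteadyZerothLaw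

end
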